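import Literature.NumberTheory.LFunctions.SiegelTatuzawaHoffsteinLemma
import Literature.NumberTheory.LFunctions.RademacherDirichletLConvexity
import Literature.NumberTheory.LFunctions.MontgomeryVaughan2001PrimeSums
import Mathlib.Analysis.SpecialFunctions.ImproperIntegrals
import HarnessLib

/-!
# Hoffstein's smoothed Perron integral shifted to `Re(s + β) = 0` (Goldfeld–Schinzel's (9))

D. Goldfeld, A. Schinzel, *On Siegel's zero*, Ann. Scuola Norm. Sup. Pisa (4) **2** (1975)
571–583, §2, proof of Theorem 1 (pp. 576–577): with `β` a real zero of `L(s, χ)` and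
`I = (1/2πi) ∫_{2−i∞}^{2+i∞} ζ(s+β) L(s+β, χ) x^s ds/(s(s+2)(s+3))`, "shifting the line of
integration to `Re(s + β) = 0`, in view of `L(β, χ) = 0`, gives
`I = L(1, χ) x^{1−β}/((1−β)(3−β)(4−β)) + O(x^{−β} √d log d)`" (display (9)), the error coming
from "Lemma 2: `|ζ(it)| ≤ c₁ √(|t|+1) log(|t|+1)`, `|L(it, χ)| ≤ c₂ √(d(|t|+1)) log(d(|t|+1))`".

We carry this out for HOFFSTEIN's kernel `K(s) = 1/(s(s+2)(s+3)(s+4)(s+5)(s+6))` (tree file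
`HoffsteinSmoothedPerron.lean`; integrand `hoffG χ β x w = ζ(w+β) L(w+β, χ) x^w K(w)` of
`SiegelTatuzawaHoffsteinLemma.lean`), which only changes the constants:

* `gs_contour_identity`: `∫_{Re w = 2−β} G − ∫_{Re w = −β} G = 2π (L(1,χ) x^{1−β} K(1−β) + F(β)/720)`
  (`F = ζ·L(·,χ)`; the second residue vanishes at a zero `β` of `L(s, χ)`), proved exactly as the
  tree's `Hoffstein1980.hoffstein_contour_identity` (residue theorem
  `integral_vertical_sub_eq_sum_of_simplePoles`, poles `1 − β` and `0`);
* `exists_hoffG_line_bound` / `exists_integral_hoffG_line_le`: on `Re w = −β`,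
  `‖G‖ ≤ C √q (2 log q + 1) x^{−β} (1 + t²)⁻¹`, hence `‖∫_{Re w = −β} G‖ ≤ C π √q (2 log q + 1) x^{−β}`
  with an ABSOLUTE constant `C`. In place of Lemma 2 (stated without proof in the source) we use
  Rademacher's uniform convexity bound `Rademacher1959.norm_LFunction_le` with `η = 1/(2 log q)`
  (`q^{η/2} = e^{1/4}`, `ζ(1+η) ≤ 1 + 1/η = 2 log q + 1`) for `L(it, χ)` and the tree's
  `exists_norm_riemannZeta_le_sq` (plus compactness on `|t| ≤ 2`) for `ζ(it)`; the kernel decays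
  like `|t|^{−6}`, so any polynomial bound in `t` suffices.

## References
- [GoldfeldSchinzel1975] D. Goldfeld, A. Schinzel, *On Siegel's zero*, Ann. SNS Pisa (4) 2 (1975) 571–583, §2 (9), Lemma 2.
- [Hoffstein1980SiegelTatuzawa] J. Hoffstein, *On the Siegel–Tatuzawa theorem*, Acta Arith. 38 (1980) 167–174, §2.
- [Rademacher1959] H. Rademacher, *On the Phragmén–Lindelöf theorem and some applications*, Math. Z. 72 (1959) 192–204, Thm 3.
-/

noncomputable section

open Complex Set MeasureTheory Filter Topology DirichletCharacter
open scoped Real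

namespace Literature.NumberTheory.LFunctions.GSPerron

open Literature.NumberTheory.LFunctions.Hoffstein1980
open Literature.NumberTheory.LFunctions.Booker2006Turing Literature.Analysis.Complex

variable {q : ℕ} [NeZero q]

/-! ### Small helpers (copies of private lemmas of `SiegelTatuzawaHoffsteinLemma.lean`) -/

/-- Non-vanishing of the linear factors on `Re w > −j`. [folklore] -/
private lemma add_ne_zero_of_re {w : ℂ} {j : ℝ} (h : -j < w.re) : w + j ≠ 0 := by
  intro h'; have := congrArg Complex.re h'; simp at this; linarith

/-- `K` is holomorphic on `Re w > −2`, `w ≠ 0`. [folklore] -/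
private lemma differentiableAt_hoffKernel {w : ℂ} (hw : -2 < w.re) (h0 : w ≠ 0) :
    DifferentiableAt ℂ hoffKernel w := by
  unfold hoffKernel
  have h2 := add_ne_zero_of_re (w := w) (j := 2) (by linarith)
  have h3 := add_ne_zero_of_re (w := w) (j := 3) (by linarith)
  have h4 := add_ne_zero_of_re (w := w) (j := 4) (by linarith)
  have h5 := add_ne_zero_of_re (w := w) (j := 5) (by linarith)
  have h6 := add_ne_zero_of_re (w := w) (j := 6) (by linarith)
  push_cast at h2 h3 h4 h5 h6
  refine (differentiableAt_const _).div (by fun_prop) ?_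
  exact mul_ne_zero (mul_ne_zero (mul_ne_zero (mul_ne_zero (mul_ne_zero h0 h2) h3) h4) h5) h6

/-- `K = K₀/(w − 0)` with `K₀(s) = 1/((s+2)(s+3)(s+4)(s+5)(s+6))` (kept as an explicit
expression: this file is theorem-only). [folklore] -/
private lemma hoffKernel_eq_K0_div {w : ℂ} (h0 : w ≠ 0) :
    hoffKernel w = (1 / ((w + 2) * (w + 3) * (w + 4) * (w + 5) * (w + 6))) / (w - 0) := by
  unfold hoffKernel; rw [sub_zero]; field_simp

/-- `K₀` is holomorphic on `Re w > −2`. [folklore] -/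
private lemma differentiableAt_hoffK0 {w : ℂ} (hw : -2 < w.re) :
    DifferentiableAt ℂ (fun w : ℂ ↦ 1 / ((w + 2) * (w + 3) * (w + 4) * (w + 5) * (w + 6))) w := by
  have h2 := add_ne_zero_of_re (w := w) (j := 2) (by linarith)
  have h3 := add_ne_zero_of_re (w := w) (j := 3) (by linarith)
  have h4 := add_ne_zero_of_re (w := w) (j := 4) (by linarith)
  have h5 := add_ne_zero_of_re (w := w) (j := 5) (by linarith)
  have h6 := add_ne_zero_of_re (w := w) (j := 6) (by linarith)
  push_cast at h2 h3 h4 h5 h6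
  refine (differentiableAt_const _).div (by fun_prop) ?_
  exact mul_ne_zero (mul_ne_zero (mul_ne_zero (mul_ne_zero h2 h3) h4) h5) h6

/-- `x^w` is entire for `x > 0`. [folklore] -/
private lemma differentiable_cpow_const {x : ℝ} (hx : 0 < x) :
    Differentiable ℂ fun w : ℂ ↦ (x : ℂ) ^ w :=
  differentiable_id.const_cpow (Or.inl (ofReal_ne_zero.2 hx.ne'))

/-- A primitive character modulo `q > 1` is non-trivial. [folklore] -/
private lemma ne_one_of_isPrimitive (hq : 1 < q) {χ : DirichletCharacter ℂ q} (hχ : χ.IsPrimitive) :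
    χ ≠ 1 := by
  rintro rfl
  have h : (1 : DirichletCharacter ℂ q).conductor = q := hχ
  rw [DirichletCharacter.conductor_one] at h; omega

/-- `‖K(w)‖ ≤ |Im w|^{-6}`. [folklore] -/
private lemma norm_hoffKernel_le_of_im {w : ℂ} (hT : 0 < |w.im|) : ‖hoffKernel w‖ ≤ 1 / |w.im| ^ 6 := by
  have hj : ∀ j : ℝ, |w.im| ≤ ‖w + j‖ := fun j ↦ by
    have := abs_im_le_norm (w + j); simpa using this
  have h0 : |w.im| ≤ ‖w‖ := abs_im_le_norm w
  unfold hoffKernel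
  rw [norm_div, norm_one]
  simp only [norm_mul]
  have h2 := hj 2; have h3 := hj 3; have h4 := hj 4; have h5 := hj 5; have h6 := hj 6
  push_cast at h2 h3 h4 h5 h6
  have hprod : |w.im| ^ 6 ≤ ‖w‖ * ‖w + 2‖ * ‖w + 3‖ * ‖w + 4‖ * ‖w + 5‖ * ‖w + 6‖ := by
    calc |w.im| ^ 6 = |w.im| * |w.im| * |w.im| * |w.im| * |w.im| * |w.im| := by ring
      _ ≤ _ := by gcongr
  exact one_div_le_one_div_of_le (by positivity) hprod

/-- `x^σ ≤ x^a + x^b` for `σ ∈ [a, b]`, `x > 0`. [folklore] -/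
private lemma rpow_le_add_of_mem {x a b σ : ℝ} (hx : 0 < x) (h1 : a ≤ σ) (h2 : σ ≤ b) :
    x ^ σ ≤ x ^ a + x ^ b := by
  have hxa : 0 < x ^ a := Real.rpow_pos_of_pos hx a
  have hxb : 0 < x ^ b := Real.rpow_pos_of_pos hx b
  rcases le_or_gt 1 x with hx1 | hx1
  · have := Real.rpow_le_rpow_of_exponent_le hx1 h2; linarith
  · have := Real.rpow_le_rpow_of_exponent_ge hx hx1.le h1; linarith

/-! ### The kernel and the two `L`-factors on the line `Re w = −β` -/

/-- On `Re w = −β`, `½ ≤ β ≤ 1`: `‖K(−β + it)‖ ≤ 128/(1 + |t|)⁶` (the factors have modulus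
`≥ (1 + |t|)/4` resp. `≥ (1 + |t|)/2`). [folklore] -/
private theorem norm_hoffKernel_line_le {β : ℝ} (hβ0 : 1 / 2 ≤ β) (hβ1 : β ≤ 1) (t : ℝ) :
    ‖hoffKernel ((-β : ℝ) + t * I)‖ ≤ 128 / (1 + |t|) ^ 6 := by
  set w : ℂ := ((-β : ℝ) : ℂ) + t * I with hw
  -- `‖w + j‖² = (j − β)² + t²`
  have hnj : ∀ j : ℝ, ‖w + j‖ ^ 2 = (j - β) ^ 2 + t ^ 2 := fun j ↦ by
    rw [Complex.sq_norm, Complex.normSq_apply]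
    simp [hw]; ring
  have ht0 : 0 ≤ |t| := abs_nonneg t
  have ht2 : |t| ^ 2 = t ^ 2 := sq_abs t
  have hsq : ∀ {u v : ℝ}, 0 ≤ u → 0 ≤ v → u ^ 2 ≤ v ^ 2 → u ≤ v := fun hu hv h ↦ by
    nlinarith
  have hβsq : 1 / 4 ≤ β ^ 2 := by nlinarith
  have hA : (1 + |t|) / 4 ≤ ‖w‖ := by
    refine hsq (by positivity) (norm_nonneg _) ?_
    have := hnj 0
    simp only [ofReal_zero, add_zero] at this
    rw [this, ← ht2, zero_sub, neg_sq]
    nlinarith [sq_nonneg (|t| - 1)]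
  have hB : ∀ j : ℝ, 2 ≤ j → (1 + |t|) / 2 ≤ ‖w + j‖ := fun j hj ↦ by
    refine hsq (by positivity) (norm_nonneg _) ?_
    have h1 : 1 ≤ (j - β) ^ 2 := by nlinarith
    rw [hnj j, ← ht2]
    nlinarith [sq_nonneg (|t| - 1)]
  have h2 := hB 2 (by norm_num); have h3 := hB 3 (by norm_num); have h4 := hB 4 (by norm_num)
  have h5 := hB 5 (by norm_num); have h6 := hB 6 (by norm_num)
  push_cast at h2 h3 h4 h5 h6
  unfold hoffKernel
  rw [norm_div, norm_one]
  simp only [norm_mul]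
  have hprod : (1 + |t|) ^ 6 / 128 ≤ ‖w‖ * ‖w + 2‖ * ‖w + 3‖ * ‖w + 4‖ * ‖w + 5‖ * ‖w + 6‖ := by
    calc (1 + |t|) ^ 6 / 128 = (1 + |t|) / 4 * ((1 + |t|) / 2) * ((1 + |t|) / 2) *
        ((1 + |t|) / 2) * ((1 + |t|) / 2) * ((1 + |t|) / 2) := by ring
      _ ≤ _ := by gcongr
  have hpos : 0 < (1 + |t|) ^ 6 / 128 := by positivity
  calc 1 / (‖w‖ * ‖w + 2‖ * ‖w + 3‖ * ‖w + 4‖ * ‖w + 5‖ * ‖w + 6‖)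
      ≤ 1 / ((1 + |t|) ^ 6 / 128) := one_div_le_one_div_of_le hpos hprod
    _ = 128 / (1 + |t|) ^ 6 := by rw [one_div_div]

/-- **`ζ(it)` is polynomially bounded**: `‖ζ(it)‖ ≤ C (1 + t²)` for all real `t`, with an
absolute `C` (Lemma 2 of the source has `√(|t|+1) log(|t|+1)`; any polynomial bound suffices
here). [cite: GoldfeldSchinzel1975, §2 Lemma 2 p. 575] -/
theorem exists_norm_riemannZeta_imAxis_le :
    ∃ C : ℝ, 0 < C ∧ ∀ t : ℝ, ‖riemannZeta (t * I)‖ ≤ C * (1 + t ^ 2) := by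
  obtain ⟨C₁, hC₁, h₁⟩ := exists_norm_riemannZeta_le_sq
  -- compactness on `|t| ≤ 2`
  have hcont : ContinuousOn (fun t : ℝ ↦ riemannZeta (t * I)) (Icc (-2) 2) := by
    refine ContinuousOn.comp (s := Icc (-2 : ℝ) 2) (t := {s : ℂ | s ≠ 1})
      (g := riemannZeta) (f := fun t : ℝ ↦ (t : ℂ) * I) ?_ (by fun_prop) ?_
    · intro s hs
      exact (differentiableAt_riemannZeta hs).continuousAt.continuousWithinAt
    · intro t _ h
      have := congrArg Complex.re h
      simp at this
  obtain ⟨C₀, hC₀⟩ := (isCompact_Icc (a := (-2 : ℝ)) (b := 2)).exists_bound_of_continuousOn hcont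
  have hC₀' : 0 ≤ C₀ := le_trans (norm_nonneg _) (hC₀ 0 (by norm_num))
  refine ⟨C₀ + C₁, by positivity, fun t ↦ ?_⟩
  rcases le_or_gt (|t|) 2 with ht | ht
  · have hmem : t ∈ Icc (-2 : ℝ) 2 := by rw [mem_Icc]; constructor <;> linarith [abs_le.mp ht]
    calc ‖riemannZeta (t * I)‖ ≤ C₀ := hC₀ t hmem
      _ ≤ (C₀ + C₁) * (1 + t ^ 2) := by nlinarith [sq_nonneg t]
  · have him : ((t : ℂ) * I).re = 0 := by simp
    have h := h₁ (t * I) (by rw [him]; norm_num) (by rw [him]; norm_num) (by simpa using ht.le)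
    simp only [mul_im, ofReal_re, I_im, ofReal_im, I_re, mul_one, mul_zero, add_zero] at h
    calc ‖riemannZeta (t * I)‖ ≤ C₁ * t ^ 2 := h
      _ ≤ (C₀ + C₁) * (1 + t ^ 2) := by nlinarith [sq_nonneg t]

/-- **`L(it, χ)` on the imaginary axis** (the substitute for Lemma 2 of the source): for `χ`
primitive modulo `q ≥ 3`, `‖L(it, χ)‖ ≤ e^{1/4} √q (2 log q + 1)(1 + |t|)` — Rademacher's
`|L(s, χ)| ≤ (q|1+s|/2π)^{(1+η−σ)/2} ζ(1+η)` at `σ = 0`, `η = 1/(2 log q)`.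
[cite: GoldfeldSchinzel1975, §2 Lemma 2 p. 575] [cite: Rademacher1959, §6 Theorem 3, p. 199] -/
theorem norm_LFunction_imAxis_le (hq : 3 ≤ q) {χ : DirichletCharacter ℂ q} (hχ : χ.IsPrimitive)
    (t : ℝ) :
    ‖χ.LFunction (t * I)‖ ≤
      Real.exp (1 / 4) * Real.sqrt q * (2 * Real.log q + 1) * (1 + |t|) := by
  have hq1 : 1 < q := by omega
  have hqR : (3 : ℝ) ≤ q := by exact_mod_cast hq
  have hq0 : (0 : ℝ) < q := by linarith
  have hlogq : 1 ≤ Real.log q := by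
    rw [Real.le_log_iff_exp_le hq0]
    have := Real.exp_one_lt_d9
    linarith
  set η : ℝ := 1 / (2 * Real.log q) with hη
  have hη0 : 0 < η := by positivity
  have hη2 : η ≤ 1 / 2 := by
    rw [hη, div_le_div_iff₀ (by positivity) (by norm_num)]; linarith
  set s : ℂ := (t : ℂ) * I with hs
  have hsre : s.re = 0 := by simp [hs]
  have hR := Rademacher1959.norm_LFunction_le hq1 hχ hη0 hη2 (s := s) (by rw [hsre]; linarith)
    (by rw [hsre]; linarith)
  rw [hsre, sub_zero] at hR
  -- `‖1 + s‖ ≤ 1 + |t|`, `‖1 + s‖ ≥ 1`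
  have hn1 : 1 ≤ ‖1 + s‖ := by
    have := abs_re_le_norm (1 + s); simpa [hs] using this
  have hn2 : ‖1 + s‖ ≤ 1 + |t| := by
    calc ‖1 + s‖ ≤ ‖(1 : ℂ)‖ + ‖s‖ := norm_add_le _ _
      _ = 1 + |t| := by simp [hs]
  -- the base `B = q‖1+s‖/2π ≤ q ‖1+s‖`
  set B : ℝ := q * ‖1 + s‖ / (2 * π) with hB
  have hB0 : 0 ≤ B := by positivity
  have hBle : B ≤ q * ‖1 + s‖ := by
    rw [hB, div_le_iff₀ (by positivity)]
    have : (1 : ℝ) ≤ 2 * π := by linarith [Real.pi_gt_three]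
    nlinarith [mul_nonneg hq0.le (norm_nonneg (1 + s))]
  have hexp0 : 0 ≤ (1 + η) / 2 := by positivity
  -- `B^{(1+η)/2} ≤ (q‖1+s‖)^{(1+η)/2} = q^{1/2} q^{η/2} ‖1+s‖^{(1+η)/2} ≤ √q e^{1/4} (1+|t|)`
  have h1 : B ^ ((1 + η) / 2) ≤ ((q : ℝ) * ‖1 + s‖) ^ ((1 + η) / 2) :=
    Real.rpow_le_rpow hB0 hBle hexp0
  have h2 : ((q : ℝ) * ‖1 + s‖) ^ ((1 + η) / 2) =
      (q : ℝ) ^ (1 / 2 : ℝ) * (q : ℝ) ^ (η / 2) * ‖1 + s‖ ^ ((1 + η) / 2) := by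
    rw [Real.mul_rpow hq0.le (norm_nonneg _), show (1 + η) / 2 = 1 / 2 + η / 2 by ring,
      Real.rpow_add hq0]
  have h3 : (q : ℝ) ^ (η / 2) = Real.exp (1 / 4) := by
    rw [Real.rpow_def_of_pos hq0, hη]
    congr 1
    field_simp
    ring
  have h4 : ‖1 + s‖ ^ ((1 + η) / 2) ≤ 1 + |t| := by
    calc ‖1 + s‖ ^ ((1 + η) / 2) ≤ ‖1 + s‖ ^ (1 : ℝ) :=
          Real.rpow_le_rpow_of_exponent_le hn1 (by linarith)
      _ = ‖1 + s‖ := Real.rpow_one _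
      _ ≤ 1 + |t| := hn2
  have h5 : (q : ℝ) ^ (1 / 2 : ℝ) = Real.sqrt q := (Real.sqrt_eq_rpow (q : ℝ)).symm
  -- `ζ(1+η) ≤ (1+η)/η = 2 log q + 1`
  have hζ : (riemannZeta (1 + η)).re ≤ 2 * Real.log q + 1 := by
    have hz := MontgomeryVaughan2001.norm_zeta_real_le (σ := 1 + η) (by linarith)
    have e : (((1 + η : ℝ)) : ℂ) = 1 + (η : ℂ) := by push_cast; ring
    rw [e] at hz
    have hq' : (1 + η) / (1 + η - 1) = 2 * Real.log q + 1 := by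
      rw [add_sub_cancel_left, hη]; field_simp
    rw [hq'] at hz
    exact (re_le_norm _).trans hz
  have hζ0 : 0 ≤ (riemannZeta (1 + η)).re := by
    have h := bigZ_pos (σ := 1 + η) (by linarith)
    rw [bigZ] at h
    have e : (((1 + η : ℝ)) : ℂ) = 1 + (η : ℂ) := by push_cast; ring
    rw [e] at h
    exact h.le
  calc ‖χ.LFunction s‖ ≤ B ^ ((1 + η) / 2) * (riemannZeta (1 + η)).re := hR
    _ ≤ (Real.sqrt q * Real.exp (1 / 4) * (1 + |t|)) * (2 * Real.log q + 1) := by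
      refine mul_le_mul ?_ hζ hζ0 (by positivity)
      calc B ^ ((1 + η) / 2) ≤ ((q : ℝ) * ‖1 + s‖) ^ ((1 + η) / 2) := h1
        _ = Real.sqrt q * Real.exp (1 / 4) * ‖1 + s‖ ^ ((1 + η) / 2) := by rw [h2, h3, h5]
        _ ≤ Real.sqrt q * Real.exp (1 / 4) * (1 + |t|) := by gcongr
    _ = Real.exp (1 / 4) * Real.sqrt q * (2 * Real.log q + 1) * (1 + |t|) := by ring

/-! ### The integrand on the line `Re w = −β` -/

/-- **The shifted line, pointwise**: there is an absolute `C` with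
`‖G(−β + it)‖ ≤ C √q (2 log q + 1) x^{−β} (1 + t²)⁻¹` for every primitive `χ` mod `q ≥ 3`,
`½ ≤ β ≤ 1`, `x > 0` (`G = ζ(w+β) L(w+β,χ) x^w K(w)`).
[cite: GoldfeldSchinzel1975, §2 proof of Theorem 1 (9) p. 576] -/
theorem exists_hoffG_line_bound :
    ∃ C : ℝ, 0 < C ∧ ∀ {q : ℕ} [NeZero q], 3 ≤ q → ∀ {χ : DirichletCharacter ℂ q}, χ.IsPrimitive →
      ∀ {β : ℝ}, 1 / 2 ≤ β → β ≤ 1 → ∀ {x : ℝ}, 0 < x → ∀ t : ℝ,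
        ‖hoffG χ β x ((-β : ℝ) + t * I)‖ ≤
          C * (Real.sqrt q * (2 * Real.log q + 1)) * x ^ (-β) * (1 + t ^ 2)⁻¹ := by
  obtain ⟨C₁, hC₁, hζ⟩ := exists_norm_riemannZeta_imAxis_le
  refine ⟨128 * Real.exp (1 / 4) * C₁, by positivity, ?_⟩
  intro q _ hq χ hχ β hβ0 hβ1 x hx t
  set w : ℂ := ((-β : ℝ) : ℂ) + t * I with hw
  have hwre : w.re = -β := by simp [hw]
  have hwβ : w + β = t * I := by rw [hw]; push_cast; ring
  have hZ := hζ t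
  have hL := norm_LFunction_imAxis_le hq hχ t
  have hK := norm_hoffKernel_line_le hβ0 hβ1 t
  have hxw : ‖(x : ℂ) ^ w‖ = x ^ (-β) := by rw [norm_cpow_eq_rpow_re_of_pos hx, hwre]
  have ht0 : 0 ≤ |t| := abs_nonneg t
  have ht2 : |t| ^ 2 = t ^ 2 := sq_abs t
  have hxβ : 0 < x ^ (-β) := Real.rpow_pos_of_pos hx _
  have hsq : 0 < Real.sqrt q * (2 * Real.log q + 1) := by
    have : (3 : ℝ) ≤ q := by exact_mod_cast hq
    have hl : 0 ≤ Real.log q := Real.log_nonneg (by linarith)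
    have : 0 < Real.sqrt q := Real.sqrt_pos.mpr (by linarith)
    positivity
  unfold hoffG
  rw [norm_mul, norm_mul, hwβ, zetaL, norm_mul, hxw]
  -- `(1+t²)(1+|t|) · 128/(1+|t|)^6 ≤ 128 (1+t²)⁻¹`
  have hpoly : (1 + t ^ 2) * (1 + |t|) * (128 / (1 + |t|) ^ 6) ≤ 128 * (1 + t ^ 2)⁻¹ := by
    have h1t : 0 < 1 + |t| := by positivity
    have h1t2 : 0 < 1 + t ^ 2 := by positivity
    rw [show (1 + t ^ 2) * (1 + |t|) * (128 / (1 + |t|) ^ 6) =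
      128 * ((1 + t ^ 2) / (1 + |t|) ^ 5) by field_simp]
    refine mul_le_mul_of_nonneg_left ?_ (by norm_num)
    rw [inv_eq_one_div, div_le_div_iff₀ (by positivity) h1t2, one_mul]
    have ha : 1 + t ^ 2 ≤ (1 + |t|) ^ 2 := by rw [← ht2]; nlinarith
    have hb : (1 + t ^ 2) * (1 + t ^ 2) ≤ (1 + |t|) ^ 2 * (1 + |t|) ^ 2 :=
      mul_le_mul ha ha h1t2.le (by positivity)
    have hc : (1 + |t|) ^ 4 ≤ (1 + |t|) ^ 5 :=
      pow_le_pow_right₀ (by linarith) (by norm_num)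
    calc (1 + t ^ 2) * (1 + t ^ 2) ≤ (1 + |t|) ^ 2 * (1 + |t|) ^ 2 := hb
      _ = (1 + |t|) ^ 4 := by ring
      _ ≤ (1 + |t|) ^ 5 := hc
  calc ‖riemannZeta (t * I)‖ * ‖χ.LFunction (t * I)‖ * x ^ (-β) * ‖hoffKernel w‖
      ≤ (C₁ * (1 + t ^ 2)) * (Real.exp (1 / 4) * Real.sqrt q * (2 * Real.log q + 1) * (1 + |t|)) *
          x ^ (-β) * (128 / (1 + |t|) ^ 6) := by
        gcongr
    _ = Real.exp (1 / 4) * C₁ * (Real.sqrt q * (2 * Real.log q + 1)) * x ^ (-β) *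
          ((1 + t ^ 2) * (1 + |t|) * (128 / (1 + |t|) ^ 6)) := by ring
    _ ≤ Real.exp (1 / 4) * C₁ * (Real.sqrt q * (2 * Real.log q + 1)) * x ^ (-β) *
          (128 * (1 + t ^ 2)⁻¹) := by gcongr
    _ = 128 * Real.exp (1 / 4) * C₁ * (Real.sqrt q * (2 * Real.log q + 1)) * x ^ (-β) *
          (1 + t ^ 2)⁻¹ := by ring

/-- The integrand is continuous along every vertical line `Re s = c` with `c + β ≠ 1`, `c > −2`,
`c ≠ 0`. [folklore] -/
private lemma continuous_hoffG_line {χ : DirichletCharacter ℂ q} (hχ1 : χ ≠ 1) {β x c : ℝ}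
    (hx : 0 < x) (hc1 : c + β ≠ 1) (hc2 : -2 < c) (hc0 : c ≠ 0) :
    Continuous fun y : ℝ ↦ hoffG χ β x (c + y * I) := by
  refine continuous_iff_continuousAt.2 fun y ↦ ?_
  have hl : Continuous fun y : ℝ ↦ (c : ℂ) + y * I := by fun_prop
  have hwre : ((c : ℂ) + y * I).re = c := by simp
  have hne1 : (c : ℂ) + y * I + β ≠ 1 := fun h ↦ hc1 (by
    have := congrArg Complex.re h; simpa using this)
  have hne0 : (c : ℂ) + y * I ≠ 0 := fun h ↦ hc0 (by
    have := congrArg Complex.re h; simpa using this)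
  have hd : DifferentiableAt ℂ (hoffG χ β x) ((c : ℂ) + y * I) := by
    unfold hoffG
    have hlin : DifferentiableAt ℂ (fun w : ℂ ↦ w + β) ((c : ℂ) + y * I) :=
      differentiableAt_id.add (differentiableAt_const _)
    have hz : DifferentiableAt ℂ (zetaL χ ∘ fun w : ℂ ↦ w + β) ((c : ℂ) + y * I) :=
      (differentiableAt_zetaL (s := (c : ℂ) + y * I + β) hχ1 hne1).comp ((c : ℂ) + y * I) hlin
    exact (hz.mul (differentiable_cpow_const hx _)).mul
      (differentiableAt_hoffKernel (by rw [hwre]; exact hc2) hne0)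
  exact ContinuousAt.comp (g := hoffG χ β x) (f := fun y : ℝ ↦ (c : ℂ) + y * I)
    hd.continuousAt hl.continuousAt

/-- **The shifted line is absolutely integrable.**
[cite: GoldfeldSchinzel1975, §2 proof of Theorem 1 (9) p. 576] -/
theorem integrable_hoffG_line (hq : 3 ≤ q) {χ : DirichletCharacter ℂ q} (hχ : χ.IsPrimitive)
    {β : ℝ} (hβ0 : 1 / 2 ≤ β) (hβ1 : β < 1) {x : ℝ} (hx : 0 < x) :
    Integrable fun y : ℝ ↦ hoffG χ β x ((-β : ℝ) + y * I) := by
  obtain ⟨C, _, hb⟩ := exists_hoffG_line_bound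
  have hχ1 := ne_one_of_isPrimitive (by omega) hχ
  refine ((integrable_inv_one_add_sq.const_mul
    (C * (Real.sqrt q * (2 * Real.log q + 1)) * x ^ (-β)))).mono' ?_
    (Eventually.of_forall fun y ↦ hb hq hχ hβ0 hβ1.le hx y)
  exact (continuous_hoffG_line hχ1 hx (by linarith) (by linarith) (by linarith)).aestronglyMeasurable

/-- **The error term of (9)**: there is an absolute `C` with
`‖∫_{Re w = −β} G‖ ≤ C √q (2 log q + 1) x^{−β}` for every primitive `χ` mod `q ≥ 3`,
`½ ≤ β < 1`, `x > 0` — the source's `O(x^{−β} √d log d)`.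
[cite: GoldfeldSchinzel1975, §2 proof of Theorem 1 (9) p. 576] -/
theorem exists_integral_hoffG_line_le :
    ∃ C : ℝ, 0 < C ∧ ∀ {q : ℕ} [NeZero q], 3 ≤ q → ∀ {χ : DirichletCharacter ℂ q}, χ.IsPrimitive →
      ∀ {β : ℝ}, 1 / 2 ≤ β → β < 1 → ∀ {x : ℝ}, 0 < x →
        ‖∫ y : ℝ, hoffG χ β x ((-β : ℝ) + y * I)‖ ≤
          C * (Real.sqrt q * (2 * Real.log q + 1)) * x ^ (-β) := by
  obtain ⟨C, hC, hb⟩ := exists_hoffG_line_bound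
  refine ⟨C * π, by positivity, ?_⟩
  intro q _ hq χ hχ β hβ0 hβ1 x hx
  have hmaj : ∀ y : ℝ, ‖hoffG χ β x ((-β : ℝ) + y * I)‖ ≤
      C * (Real.sqrt q * (2 * Real.log q + 1)) * x ^ (-β) * (1 + y ^ 2)⁻¹ :=
    fun y ↦ hb hq hχ hβ0 hβ1.le hx y
  calc ‖∫ y : ℝ, hoffG χ β x ((-β : ℝ) + y * I)‖
      ≤ ∫ y : ℝ, ‖hoffG χ β x ((-β : ℝ) + y * I)‖ := norm_integral_le_integral_norm _
    _ ≤ ∫ y : ℝ, C * (Real.sqrt q * (2 * Real.log q + 1)) * x ^ (-β) * (1 + y ^ 2)⁻¹ :=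
        integral_mono_of_nonneg (Eventually.of_forall fun y ↦ norm_nonneg _)
          (integrable_inv_one_add_sq.const_mul _) (Eventually.of_forall hmaj)
    _ = C * (Real.sqrt q * (2 * Real.log q + 1)) * x ^ (-β) * π := by
        rw [integral_const_mul, integral_univ_inv_one_add_sq]
    _ = C * π * (Real.sqrt q * (2 * Real.log q + 1)) * x ^ (-β) := by ring

/-! ### The contour shift to `Re(s + β) = 0` -/

/-- **Goldfeld–Schinzel's shift (9) for Hoffstein's kernel.** For a primitive `χ` modulo `q ≥ 3`,
`½ < β < 1` and `x > 0`:
`∫_{Re w = 2−β} G − ∫_{Re w = −β} G = 2π (L(1,χ) x^{1−β} K(1−β) + F(β)/720)`,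
`F = ζ · L(·, χ)` — the residues at the pole `w = 1 − β` of `ζ(w + β)` and at the pole `w = 0` of
the kernel (the latter vanishes when `L(β, χ) = 0`, "in view of `L(β, χ) = 0`").
[cite: GoldfeldSchinzel1975, §2 proof of Theorem 1 (9) p. 576]
[cite: Hoffstein1980SiegelTatuzawa, §2 proof of Lemma 1 (3) p. 169] -/
theorem gs_contour_identity (hq : 3 ≤ q) {χ : DirichletCharacter ℂ q} (hχ : χ.IsPrimitive)
    {β : ℝ} (hβ0 : 1 / 2 < β) (hβ1 : β < 1) {x : ℝ} (hx : 0 < x) :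
    (∫ y : ℝ, hoffG χ β x (↑(2 - β) + y * I)) - ∫ y : ℝ, hoffG χ β x (↑(-β) + y * I) =
      2 * π * (χ.LFunction 1 * (x : ℂ) ^ ((1 : ℂ) - β) * hoffKernel ((1 : ℂ) - β) +
        zetaL χ β / 720) := by
  have hq1 : 1 < q := by omega
  have hχ1 : χ ≠ 1 := ne_one_of_isPrimitive hq1 hχ
  set a : ℝ := -β with ha
  set b : ℝ := 2 - β with hb
  have hab : a < b := by rw [ha, hb]; linarith
  set p₁ : ℂ := (1 : ℂ) - β with hp₁
  classical
  set S : Finset ℂ := {p₁, 0} with hS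
  set r : ℂ → ℂ := fun p ↦ if p = p₁ then χ.LFunction 1 * (x : ℂ) ^ p₁ * hoffKernel p₁
    else zetaL χ β / 720 with hr
  have hp₁re : p₁.re = 1 - β := by simp [hp₁]
  have hp₁0 : p₁ ≠ 0 := fun h ↦ by
    have := congrArg Complex.re h; rw [hp₁re] at this; simp at this; linarith
  have hsum : ∑ p ∈ S, r p = χ.LFunction 1 * (x : ℂ) ^ p₁ * hoffKernel p₁ + zetaL χ β / 720 := by
    rw [hS, Finset.sum_insert (by simp [hp₁0]), Finset.sum_singleton]
    simp only [hr, if_neg hp₁0.symm, if_true]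
  set U : Set ℂ := {w : ℂ | -2 < w.re} with hU
  have hUo : IsOpen U := isOpen_lt continuous_const Complex.continuous_re
  have hxw := differentiable_cpow_const hx
  have hmemS : ∀ p : ℂ, p ∈ S ↔ p = p₁ ∨ p = 0 := fun p ↦ by
    rw [hS, Finset.mem_insert, Finset.mem_singleton]
  -- growth constant for the decay
  obtain ⟨C, hC, hgrowth⟩ := exists_norm_zetaL_le_pow hq1 hχ
  have key := integral_vertical_sub_eq_sum_of_simplePoles (F := hoffG χ β x) hab S r U hUo
    (fun w hw ↦ by
      simp only [mem_preimage, mem_Icc] at hw; show -2 < w.re; rw [ha] at hw; linarith)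
    (fun p hp ↦ by
      rcases (hmemS p).1 hp with rfl | rfl
      · rw [hp₁re, ha, hb]; constructor <;> linarith
      · rw [ha, hb]; simp; constructor <;> linarith)
    ?hF ?hpole ?hia ?hib ?hdecay
  · rw [key, hsum]
  -- (hF) holomorphy off the poles
  · intro w hw
    rcases hw with ⟨hwU, hwS⟩
    have hwU' : -2 < w.re := hwU
    have hwS' : ¬ (w = p₁ ∨ w = 0) := fun h ↦ hwS ((hmemS w).2 h)
    push Not at hwS'
    obtain ⟨hw1, hw0⟩ := hwS'
    have hwβ : w + β ≠ 1 := fun h ↦ hw1 (by rw [hp₁]; linear_combination h)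
    refine DifferentiableAt.differentiableWithinAt ?_
    unfold hoffG
    have hlin : DifferentiableAt ℂ (fun w : ℂ ↦ w + β) w :=
      differentiableAt_id.add (differentiableAt_const _)
    have hz : DifferentiableAt ℂ (zetaL χ ∘ fun w : ℂ ↦ w + β) w :=
      (differentiableAt_zetaL (s := w + β) hχ1 hwβ).comp w hlin
    exact (hz.mul (hxw w)).mul (differentiableAt_hoffKernel hwU' hw0)
  -- (hpole) the two simple poles
  · intro p hp
    rcases (hmemS p).1 hp with rfl | rfl
    · -- `s = 1 − β`: pole of `ζ(s + β)`
      set V : Set ℂ := {w : ℂ | w ≠ 0 ∧ -2 < w.re} with hV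
      refine ⟨fun w ↦ zetaReg1 (w + β) * χ.LFunction (w + β) * (x : ℂ) ^ w * hoffKernel w, V,
        ?_, ?_, ?_, ?_⟩
      · exact (isOpen_ne.inter (isOpen_lt continuous_const Complex.continuous_re)).mem_nhds
          ⟨hp₁0, by show -2 < p₁.re; rw [hp₁re]; linarith⟩
      · intro w hw
        rcases hw with ⟨hw0, hw2⟩
        refine DifferentiableAt.differentiableWithinAt ?_
        have hlin : DifferentiableAt ℂ (fun w : ℂ ↦ w + β) w :=
          differentiableAt_id.add (differentiableAt_const _)
        have hz : DifferentiableAt ℂ (fun w : ℂ ↦ zetaReg1 (w + β)) w :=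
          (differentiable_zetaReg1 _).comp w hlin
        have hL : DifferentiableAt ℂ (fun w : ℂ ↦ χ.LFunction (w + β)) w :=
          (differentiable_LFunction hχ1 _).comp w hlin
        exact ((hz.mul hL).mul (hxw w)).mul (differentiableAt_hoffKernel hw2 hw0)
      · simp only [hr, if_pos rfl]
        rw [show p₁ + β = 1 by rw [hp₁]; ring, zetaReg1_mul_LFunction_one]
      · intro w _ hwp
        have hwβ : w + β ≠ 1 := fun h ↦ hwp (by rw [hp₁]; linear_combination h)
        unfold hoffG
        rw [zetaL_eq_div_of_ne_one χ hwβ, show w + ↑β - 1 = w - p₁ by rw [hp₁]; ring]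
        field_simp
    · -- `s = 0`: pole of the kernel
      set V : Set ℂ := {w : ℂ | w ≠ p₁ ∧ -2 < w.re} with hV
      refine ⟨fun w ↦ zetaL χ (w + β) * (x : ℂ) ^ w *
        (1 / ((w + 2) * (w + 3) * (w + 4) * (w + 5) * (w + 6))), V, ?_, ?_, ?_, ?_⟩
      · exact (isOpen_ne.inter (isOpen_lt continuous_const Complex.continuous_re)).mem_nhds
          ⟨hp₁0.symm, by show -2 < (0:ℂ).re; simp⟩
      · intro w hw
        rcases hw with ⟨hw1, hw2⟩
        have hwβ : w + β ≠ 1 := fun h ↦ hw1 (by rw [hp₁]; linear_combination h)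
        refine DifferentiableAt.differentiableWithinAt ?_
        have hlin : DifferentiableAt ℂ (fun w : ℂ ↦ w + β) w :=
          differentiableAt_id.add (differentiableAt_const _)
        have hz : DifferentiableAt ℂ (zetaL χ ∘ fun w : ℂ ↦ w + β) w :=
          (differentiableAt_zetaL (s := w + β) hχ1 hwβ).comp w hlin
        exact (hz.mul (hxw w)).mul (differentiableAt_hoffK0 hw2)
      · simp only [hr, if_neg hp₁0.symm]
        rw [zero_add, cpow_zero, mul_one]
        ring
      · intro w _ hw0
        unfold hoffG
        rw [hoffKernel_eq_K0_div hw0]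
        field_simp
  -- (hia) integrability on the left line
  · exact integrable_hoffG_line hq hχ hβ0.le hβ1 hx
  -- (hib) integrability on the right line
  · have hb0 : 0 < b := by rw [hb]; linarith
    have hK := integrable_hoffKernel_vertical hb0
    have hcont : Continuous fun y : ℝ ↦ zetaL χ (↑b + y * I + β) * (x : ℂ) ^ ((b : ℂ) + y * I) := by
      refine Continuous.mul ?_ ((differentiable_cpow_const hx).continuous.comp (by fun_prop))
      refine continuous_iff_continuousAt.2 fun y ↦ ?_
      have hne : (b : ℂ) + y * I + β ≠ 1 := by
        intro h
        have h' := congrArg Complex.re h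
        simp only [add_re, ofReal_re, mul_re, I_re, I_im, ofReal_im, mul_zero, zero_mul, sub_zero,
          one_re] at h'
        rw [hb] at h'; linarith
      exact ContinuousAt.comp (g := zetaL χ) (f := fun y : ℝ ↦ (b : ℂ) + y * I + β)
        (differentiableAt_zetaL hχ1 hne).continuousAt
        (by fun_prop : Continuous fun y : ℝ ↦ (b : ℂ) + y * I + β).continuousAt
    have hZ2 : 0 ≤ bigZ 2 := (bigZ_pos (by norm_num)).le
    have hint := hK.bdd_mul hcont.aestronglyMeasurable (c := bigZ 2 * bigZ 2 * x ^ b)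
      (Eventually.of_forall fun y ↦ by
        rw [norm_mul, norm_cpow_eq_rpow_re_of_pos hx]
        have hre : ((b : ℂ) + y * I).re = b := by simp
        rw [hre]
        have e : (b : ℂ) + y * I + β = ((2 : ℝ) : ℂ) + y * I := by rw [hb]; push_cast; ring
        rw [e, zetaL, norm_mul]
        have h1 := norm_riemannZeta_le_bigZ (σ := 2) (by norm_num) y
        have h2 := norm_LFunction_le_bigZ χ (σ := 2) (by norm_num) y
        have hxb : 0 ≤ x ^ b := (Real.rpow_pos_of_pos hx b).le
        calc ‖riemannZeta (↑(2:ℝ) + y * I)‖ * ‖χ.LFunction (↑(2:ℝ) + y * I)‖ * x ^ b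
            ≤ bigZ 2 * bigZ 2 * x ^ b := by gcongr)
    exact hint
  -- (hdecay) the horizontal sides
  · intro ε hε
    set M : ℝ := x ^ a + x ^ b with hM
    have hM0 : 0 < M := by
      rw [hM]; exact add_pos (Real.rpow_pos_of_pos hx a) (Real.rpow_pos_of_pos hx b)
    refine ⟨max 2 (C * M / ε), fun T hT σ hσ ↦ ?_⟩
    have hT2 : 2 ≤ |T| := (le_max_left _ _).trans hT
    have hT1 : C * M / ε ≤ |T| := (le_max_right _ _).trans hT
    have hTpos : 0 < |T| := by linarith
    set w : ℂ := (σ : ℂ) + T * I with hw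
    have hwre : w.re = σ := by simp [hw]
    have hwim : w.im = T := by simp [hw]
    have hz : ‖zetaL χ (w + β)‖ ≤ C * T ^ 4 := by
      have := hgrowth (w + β) (by simp [hw]; rw [ha] at hσ; linarith [hσ.1])
        (by simp [hw]; rw [hb] at hσ; linarith [hσ.2]) (by simpa [hw] using hT2)
      simpa [hw] using this
    have hxσ : ‖(x : ℂ) ^ w‖ ≤ M := by
      rw [norm_cpow_eq_rpow_re_of_pos hx, hwre]; exact rpow_le_add_of_mem hx hσ.1 hσ.2
    have hKn : ‖hoffKernel w‖ ≤ 1 / |T| ^ 6 := by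
      have := norm_hoffKernel_le_of_im (w := w) (by rw [hwim]; exact hTpos); rwa [hwim] at this
    have hT4 : T ^ 4 = |T| ^ 4 := (Even.pow_abs (by norm_num : Even 4) T).symm
    have hTT : |T| ≤ |T| ^ 2 := by nlinarith
    calc ‖hoffG χ β x w‖ = ‖zetaL χ (w + β)‖ * ‖(x : ℂ) ^ w‖ * ‖hoffKernel w‖ := by
          unfold hoffG; rw [norm_mul, norm_mul]
      _ ≤ (C * T ^ 4) * M * (1 / |T| ^ 6) := by gcongr
      _ = C * M / |T| ^ 2 := by rw [hT4]; field_simp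
      _ ≤ C * M / |T| := div_le_div_of_nonneg_left (by positivity) hTpos hTT
      _ ≤ ε := by rw [div_le_iff₀ hTpos]; rw [div_le_iff₀ hε] at hT1; linarith

end Literature.NumberTheory.LFunctions.GSPerron

end
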